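import Literature.NumberTheory.DiophantineGeometry.GenEllDeCriticalValuesFamily
import Mathlib.FieldTheory.SplittingField.IsSplittingField
import Mathlib.FieldTheory.IsAlgClosed.Basic
import Mathlib.Analysis.Complex.Polynomial.Basic
import HarnessLib

/-!
# A number field over which `R_c` splits and which contains the critical values of `t_c`
# (GenEllTwo, W5c/CRIT for the family: the field-of-definition inputs of the converse junctions)

S. Mochizuki, *Arithmetic elliptic curves in general position*, Math. J. Okayama Univ. **52** (2010),
proof of Thm. 2.1 (ii) ⇒ (i), p. 12 [cite: MochizukiGenEll2010, Thm 2.1 p.12]; abc-iut cell,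
route item `Summit.ABC.ABC.Theses.IUTThetaPilot.GenEllTwo`, package note `GENELLTWO-P1ROUTE.md` and
OWNER RULING #6 (family `t_c`).  The good-prime converse ("(G2)") for the member `t_c` —
`DeCrit.exists_mem_valuation_tC_sub_lt_one'` (`GenEllDeCriticalLocusFamilyReduction.lean`) and its
number-field packaging `DeC.hconv_off_badPrimes` / `DeC.hmeet_hoff_of_critValues`
(`GenEllDeFamilyBadPrimesConverse.lean`, abc-iut-w5-d054) — is stated over a base field `K` in which
(a) the critical-locus polynomial `R_c = c²α² − β³` SPLITS and (b) the critical values `t_c(Q_θ)` lie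
in the chosen finite set `B ⊆ K`.  This proof-only file discharges both field-of-definition inputs
from data over `ℂ`:

* `splits_RpolyC_of_forall_root_mem_range` — for any field `K` with `σ : K →+* ℂ`: if every
  complex root of `R_c` lies in the range of `σ`, then `R_c ∈ K[X]` splits (`c ∈ ℚ`);
* `exists_intermediateField_splits_RpolyC` — for `c ∈ ℚ` and any finite set `S ⊂ ℂ` of algebraic
  numbers there is an intermediate field `ℚ ⊆ K ⊆ ℂ`, finite-dimensional over `ℚ`, containing `S`,
  all complex roots of `R_c`, and `critSetC k c`, over which `R_c` splits — the field `K_c` of the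
  W5 coordinator's closure map ("A_c := crit(t_c), a Finset over the number field K_c");
* `forall_root_tC_mem_of_critSetC_subset_val_image` — for such `K` (or any intermediate field) and a
  finite `B ⊆ K` whose image in `ℂ` contains `critSetC k c`: `t_c(Q_θ) ∈ B` for every root
  `θ ∈ K` of `R_c` (the `hcritB` hypothesis; same transport as `forall_root_tC_mem_of_critSetC_subset_image`);
* `exists_finset_val_image_eq` (a finite `B ⊂ ℂ` inside `K` is the image of a `Finset K`).  (That such a
  `K` is a `NumberField` is `NumberField.mk` from `FiniteDimensional ℚ K`; in the tree already as
  `Literature.NumberTheory.Transcendental.Baker1975.Ch3.HB.numberField`.)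

Classical; theorems only; no named facts.  Nothing here bears on the disputed parts of the abc-iut
corpus.
-/

noncomputable section

open Polynomial

namespace Literature.NumberTheory.DiophantineGeometry.GenEll

namespace DeCrit

variable {k : ℕ}

/-- Over `ℂ`, `R_c` splits (algebraically closed). [cite: MochizukiGenEll2010, Thm 2.1 p.12] -/
theorem splits_RpolyC_complex (k : ℕ) (c : ℂ) : (RpolyC k c).Splits :=
  IsAlgClosed.splits _

/-- For `c ∈ ℚ` and a field homomorphism `σ : K →+* ℂ`: `(R_c ∈ K[X]).map σ = R_c ∈ ℂ[X]`.
[cite: MochizukiGenEll2010, Thm 2.1 p.12] -/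
theorem map_RpolyC_ratCast {K : Type*} [Field K] [CharZero K] (σ : K →+* ℂ) (k : ℕ) (c : ℚ) :
    (RpolyC k (c : K)).map σ = RpolyC k (c : ℂ) := by
  rw [map_RpolyC, map_ratCast]

/-- **Splitting of `R_c` over a field containing its complex roots.** If `σ : K →+* ℂ` and every
complex root of `R_c` (`c ∈ ℚ`) lies in the range of `σ`, then `R_c ∈ K[X]` splits — the `hsplit`
hypothesis of the converse junctions. [cite: MochizukiGenEll2010, Thm 2.1 p.12] -/
theorem splits_RpolyC_of_forall_root_mem_range {K : Type*} [Field K] [CharZero K] (σ : K →+* ℂ)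
    (k : ℕ) (c : ℚ) (h : ∀ θ : ℂ, (RpolyC k (c : ℂ)).eval θ = 0 → θ ∈ σ.range) :
    (RpolyC k (c : K)).Splits := by
  refine Splits.of_splits_map σ ?_ ?_
  · rw [map_RpolyC_ratCast]; exact splits_RpolyC_complex k _
  · intro a ha
    rw [map_RpolyC_ratCast] at ha
    exact h a ((mem_roots (RpolyC_ne_zero k _)).mp ha)

/-- The complex roots of `R_c` (`c ∈ ℚ`) are integral over `ℚ`. [cite: MochizukiGenEll2010, Thm 2.1 p.12] -/
theorem isIntegral_of_eval_RpolyC_complex {c : ℚ} {θ : ℂ} (hθ : (RpolyC k (c : ℂ)).eval θ = 0) :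
    IsIntegral ℚ θ :=
  isIntegral_of_eval_RpolyC hθ

/-- **The number field `K_c`.** For `c ∈ ℚ` and any finite set `S ⊂ ℂ` of algebraic numbers there is
an intermediate field `ℚ ⊆ K ⊆ ℂ`, finite-dimensional over `ℚ` (a number field), which contains `S`,
every complex root of `R_c`, and the critical-value set `critSetC k c`, and over which `R_c` splits.
[cite: MochizukiGenEll2010, Thm 2.1 p.12] -/
theorem exists_intermediateField_splits_RpolyC (k : ℕ) (c : ℚ) (S : Set ℂ) (hSfin : S.Finite)
    (hS : ∀ x ∈ S, IsIntegral ℚ x) :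
    ∃ K : IntermediateField ℚ ℂ, FiniteDimensional ℚ K ∧
      S ⊆ (K : Set ℂ) ∧
      (∀ θ : ℂ, (RpolyC k (c : ℂ)).eval θ = 0 → θ ∈ K) ∧
      (↑(critSetC k c) : Set ℂ) ⊆ (K : Set ℂ) ∧
      (RpolyC k (c : K)).Splits := by
  classical
  -- the finite generating set: `S`, the complex roots of `R_c`, and the critical values
  let R : Set ℂ := {θ | (RpolyC k (c : ℂ)).eval θ = 0}
  have hRfin : R.Finite := by
    have : R = ↑((RpolyC k (c : ℂ)).roots.toFinset) := by
      ext θ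
      simp [R, Multiset.mem_toFinset, mem_roots (RpolyC_ne_zero k (c : ℂ))]
    rw [this]; exact Finset.finite_toSet _
  let T : Set ℂ := S ∪ R ∪ ↑(critSetC k c)
  have hTfin : T.Finite := (hSfin.union hRfin).union (Finset.finite_toSet _)
  haveI : Finite T := hTfin.to_subtype
  have hT : ∀ x ∈ T, IsIntegral ℚ x := by
    intro x hx
    rcases hx with (hx | hx) | hx
    · exact hS x hx
    · exact isIntegral_of_eval_RpolyC_complex hx
    · exact isIntegral_of_mem_critSetC (Finset.mem_coe.mp hx)
  refine ⟨IntermediateField.adjoin ℚ T, IntermediateField.finiteDimensional_adjoin hT, ?_, ?_, ?_, ?_⟩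
  · exact fun x hx => IntermediateField.subset_adjoin ℚ T (Or.inl (Or.inl hx))
  · exact fun θ hθ => IntermediateField.subset_adjoin ℚ T (Or.inl (Or.inr hθ))
  · exact fun x hx => IntermediateField.subset_adjoin ℚ T (Or.inr hx)
  · refine splits_RpolyC_of_forall_root_mem_range (IntermediateField.adjoin ℚ T).val.toRingHom k c ?_
    intro θ hθ
    exact ⟨⟨θ, IntermediateField.subset_adjoin ℚ T (Or.inl (Or.inr hθ))⟩, rfl⟩

/-- The `hcritB` hypothesis inside an intermediate field `K ⊆ ℂ`: if `B ⊆ K` is finite and its image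
in `ℂ` contains `critSetC k c`, then `t_c(Q_θ) ∈ B` for every root `θ ∈ K` of `R_c`.
[cite: MochizukiGenEll2010, Thm 2.1 p.12] -/
theorem forall_root_tC_mem_of_critSetC_subset_val_image (K : IntermediateField ℚ ℂ) {c : ℚ}
    {B : Finset K} (hB : ↑(critSetC k c) ⊆ ((↑) : K → ℂ) '' ↑B) :
    ∀ θ : K, (RpolyC k (c : K)).eval θ = 0 →
      ((1 - 2 * critXC k (c : K) θ) + (c : K) * θ ^ (k + 2)) / (θ * (1 - 2 * critXC k (c : K) θ)) ∈
        B := by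
  -- (self-contained copy of the transport argument of `forall_root_tC_mem_of_critSetC_subset_image`
  -- at `σ := K.val`)
  intro θ hθ
  set σ : K →+* ℂ := K.val.toRingHom with hσ
  have hθ' : (RpolyC k (c : ℂ)).eval (σ θ) = 0 := by
    have h := eval_RpolyC_map σ k (c : K) θ
    rw [map_ratCast, hθ, map_zero] at h
    exact h
  have hmem := hB (tC_critPointC_mem_critSetC (k := k) hθ')
  rw [critPointC_fst, critPointC_snd] at hmem
  obtain ⟨b, hb, hbe⟩ := hmem
  have e : σ (((1 - 2 * critXC k (c : K) θ) + (c : K) * θ ^ (k + 2)) /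
      (θ * (1 - 2 * critXC k (c : K) θ))) = tC k (c : ℂ) (critXC k (c : ℂ) (σ θ)) (σ θ) := by
    rw [show ((1 - 2 * critXC k (c : K) θ) + (c : K) * θ ^ (k + 2)) /
        (θ * (1 - 2 * critXC k (c : K) θ)) = tC k (c : K) (critXC k (c : K) θ) θ from rfl,
      map_tC, map_critXC, map_ratCast]
  have hbe' : σ b = σ (((1 - 2 * critXC k (c : K) θ) + (c : K) * θ ^ (k + 2)) /
      (θ * (1 - 2 * critXC k (c : K) θ))) := by rw [e]; exact hbe
  rwa [← σ.injective hbe']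

/-- Any finite `B ⊂ ℂ` contained in the intermediate field `K` is the image of a finite `B' ⊆ K`
(bookkeeping for building the `Finset K` of the junctions from a `Finset ℂ`).
[cite: MochizukiGenEll2010, Thm 2.1 p.12] -/
theorem exists_finset_val_image_eq (K : IntermediateField ℚ ℂ) (B : Finset ℂ)
    (hB : (↑B : Set ℂ) ⊆ (K : Set ℂ)) :
    ∃ B' : Finset K, ((↑) : K → ℂ) '' ↑B' = ↑B := by
  classical
  refine ⟨B.subtype (· ∈ K), ?_⟩
  ext b
  simp only [Set.mem_image, Finset.mem_coe, Finset.mem_subtype]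
  constructor
  · rintro ⟨x, hx, rfl⟩; exact hx
  · intro hb; exact ⟨⟨b, hB (Finset.mem_coe.mpr hb)⟩, hb, rfl⟩

end DeCrit

end Literature.NumberTheory.DiophantineGeometry.GenEll

end
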